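import Summits.KontsevichZagierPeriods.KontsevichZagierPeriods.Theses.SiegelTamagawa
import Summits.KontsevichZagierPeriods.KontsevichZagierPeriods.Theorems.InverseLandauTateLiftingMinkowskiBinaryAccessible

/-!
# `MinkowskiBinaryAccessible` (stmt-KontsevichZagierPeriods-4419, route SiegelTamagawa) — proof

The cone `{2|y₂| ≤ y₀ ≤ y₁, 0 < y₀y₁ − y₂² < 1} ⊆ ℝ³` of Minkowski-reduced positive binary quadratic
forms of discriminant `< 1`, with integrand `1`, is equivalent in the Kontsevich–Zagier calculus to the
open disc `x² + y² < 2/9` with integrand `1` (both represent `2π/9`): for any representations `r`, `r'`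
with these domains and these integrands on them, `KZ.Equivalent r r'`. This is verbatim
`InverseLandau.tateLifting_minkowskiBinaryAccessible`
(Theorems/InverseLandauTateLiftingMinkowskiBinaryAccessible.lean; stub `stub_minkowskiBinaryAccessible`
of line `Sketch` of the crux `TateLifting`, lead c10): Newton–Leibniz along `y₁`, the shear `y₂ = y₀t`,
Newton–Leibniz along `y₀` with the semialgebraic edge `1/√(1 − t²)`, and the conic-band kernel between the
arcsine one-form `[{t² ≤ ¼}, 2/(3√(1 − t²))]` and the disc as a band of the conic `9(t² + s²) = 2`.
-/

namespace Summit.KontsevichZagierPeriods.SiegelTamagawa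

/-- **`MinkowskiBinaryAccessible`** (route SiegelTamagawa, stmt-KontsevichZagierPeriods-4419): the volume
of the cone of Minkowski-reduced positive binary forms of discriminant `< 1` is KZ-equivalent to the open
disc of radius `√(2/9)`. Proof: `InverseLandau.tateLifting_minkowskiBinaryAccessible`.
[cite: KontsevichZagier2001, §1.2] -/
theorem minkowskiBinaryAccessible_proof :
    Summit.KontsevichZagierPeriods.KontsevichZagierPeriods.Theses.SiegelTamagawa.MinkowskiBinaryAccessible :=
  Summit.KontsevichZagierPeriods.InverseLandau.tateLifting_minkowskiBinaryAccessible

end Summit.KontsevichZagierPeriods.SiegelTamagawa
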